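import Mathlib.Geometry.Manifold.Instances.Real
import Summits.SmoothPoincare4.SmoothPoincare4.Theorems.DottedCircleRasmussenDcrGapHelperFriendsPi1G3Aux1

/-!
# Helper `helper_friendsPi1_G3` (loops off the core), aux file 2: general position for paths on a manifold
(sub-goal G3 of stub `stub_friendsPi1`, line `mk_friends`, crux `DcrGap`;
item stmt-SmoothPoincare4-16128, route route-SmoothPoincare4-DottedCircleRasmussen)

The local, manifold form of general position for paths with respect to a set `S` of codimension
`≥ 2` (a set covered by countably many `C¹` images of a parameter space `P`, `dim P + 2 ≤ dim M`):

* `exists_goodChartNhd` — about every interior point `x` of a `C¹` manifold `M` and inside any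
  neighbourhood of `x` there is an open chart ball `N` such that (a) every point of `N` is joined
  inside `N` to a point of `N ∖ S` (the complement of the chart image of `S` is dense), and (b) every
  path inside `N` with end points off `S` is homotopic rel end points to a path in `N ∖ S` (general
  position in the chart ball, `FriendsPi1.exists_path_homotopicWithin_forall_notMem`, transported back
  by the inverse chart).  This is the pointwise datum fed to the path-cover lemma of aux file 1; it is
  the smooth, local form of "a closed set of dimension `≤ n - 2` does not separate an `n`-manifold,
  not even locally" (Hurewicz–Wallman (1941), Thm. IV 4 and Cor. 1);
* the registered helper `helper_friendsPi1_G3_genpos`: the case of a smooth `4`-manifold `X` and a set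
  `S ⊆ f(ℝ²)` for a smooth map `f : ℝ² → X` (in the application, the core disc `f₀(𝔻²)`).

Everything is proved; no definitions, no named facts, no `sorry`.

## References

* W. Hurewicz, H. Wallman, *Dimension Theory*, Princeton (1941), Ch. IV §5, Thm. IV 4. [HurewiczWallman1941]
* A. Hatcher, *Algebraic Topology*, CUP (2002), §1.2, proof of Lemma 1.15. [HatcherAT2002]
-/

-- the prescribed namespace `Summit.<P>.<Sub>.…` duplicates `SmoothPoincare4` (P = Sub)
set_option linter.dupNamespace false
set_option linter.style.longLine false

noncomputable section

open scoped Manifold ContDiff Topology unitInterval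
open Set Function Metric Module Filter
open Literature.AlgebraicTopology.FundamentalGroup Literature.Topology.FourManifolds
open Literature.AlgebraicTopology.FundamentalGroup.VanKampen (HomotopicWithin)

namespace Summit.SmoothPoincare4.SmoothPoincare4.Theorems.DcrGap.MkFriends

namespace FriendsPi1

universe u

section Manifold

variable {E : Type*} [NormedAddCommGroup E] [NormedSpace ℝ E] [FiniteDimensional ℝ E]
  {H : Type*} [TopologicalSpace H] {J : ModelWithCorners ℝ E H}
  {M : Type u} [TopologicalSpace M] [ChartedSpace H M] [IsManifold J 1 M]
  {P : Type*} [NormedAddCommGroup P] [NormedSpace ℝ P] [FiniteDimensional ℝ P]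

/-- **Good chart balls for paths, in general position with respect to `S`.**  Let `S ⊆ M` be covered
by countably many `C¹` images `gᵢ(Uᵢ)` of open subsets of `P`, `dim P + 2 ≤ dim E`, and `x` an
interior point of the `C¹` manifold `M`.  Inside any neighbourhood of `x` there is an open
neighbourhood `N` (a chart ball) such that (a) every point `p ∈ N` is joined inside `N` to a point of
`N ∖ S`, and (b) every path inside `N` with end points off `S` is homotopic rel end points to a path in
`N ∖ S`.  In the chart, the image of `S` is again a countable union of `C¹` images, so its complement
is dense (for (a): a segment to a nearby point off it) and paths in the ball are moved off it rel end
points (`exists_path_homotopicWithin_forall_notMem`, for (b)); the inverse chart carries segments,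
paths and homotopies back. [cite: HurewiczWallman1941, Ch. IV §5, Thm. IV 4 and Cor. 1] -/
theorem exists_goodChartNhd (hdim : finrank ℝ P + 2 ≤ finrank ℝ E) {S : Set M}
    {ι : Type*} [Countable ι] (g : ι → P → M) (U : ι → Set P) (hU : ∀ i, IsOpen (U i))
    (hg : ∀ i, ContMDiffOn 𝓘(ℝ, P) J 1 (g i) (U i)) (hS : S ⊆ ⋃ i, g i '' U i) {x : M}
    (hx : J.IsInteriorPoint x) {V : Set M} (hV : V ∈ 𝓝 x) :
    ∃ N : Set M, IsOpen N ∧ x ∈ N ∧ N ⊆ V ∧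
      (∀ p ∈ N, ∃ q ∈ N, q ∉ S ∧ ∃ δ : Path p q, ∀ s, δ s ∈ N) ∧
      ∀ {p q : M} (β : Path p q), (∀ s, β s ∈ N) → p ∉ S → q ∉ S →
        ∃ β' : Path p q, (∀ s, β' s ∈ N ∧ β' s ∉ S) ∧ β.Homotopic β' := by
  have h2 : (extChartAt J x).symm ⁻¹' V ∈ 𝓝 (extChartAt J x x) :=
    (continuousAt_extChartAt_symm x).preimage_mem_nhds (by rw [extChartAt_to_inv]; exact hV)
  set e := extChartAt J x with he
  -- the chart ball
  have h1 : interior e.target ∈ 𝓝 (e x) := isOpen_interior.mem_nhds (J.isInteriorPoint_iff.1 hx)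
  obtain ⟨r, hr, hball⟩ : ∃ r > 0, ball (e x) r ⊆ interior e.target ∩ e.symm ⁻¹' V :=
    Metric.mem_nhds_iff.1 (inter_mem h1 h2)
  have htarget : ball (e x) r ⊆ e.target := fun z hz => interior_subset (hball hz).1
  set C : Set E := ball (e x) r with hC
  set N : Set M := e.source ∩ e ⁻¹' C with hN
  -- the chart image of `S` and its parametrisation
  set T : Set E := e.target ∩ e.symm ⁻¹' S with hT
  set W : ι → Set P := fun i => U i ∩ g i ⁻¹' e.source with hW
  set h : ι → P → E := fun i w => e (g i w) with hh
  have hWo : ∀ i, IsOpen (W i) := fun i =>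
    (hg i).continuousOn.isOpen_inter_preimage (hU i) (isOpen_extChartAt_source x)
  have hhd : ∀ i, ContDiffOn ℝ 1 (h i) (W i) := fun i => by
    have h' : ContMDiffOn 𝓘(ℝ, P) 𝓘(ℝ, E) 1 (h i) (W i) := by
      refine (contMDiffOn_extChartAt (n := 1) (x := x)).comp ((hg i).mono inter_subset_left)
        fun w hw => ?_
      rw [← extChartAt_source J]; exact hw.2
    exact contMDiffOn_iff_contDiffOn.1 h'
  have hTsub : T ⊆ ⋃ i, h i '' W i := by
    rintro z ⟨hzt, hzS⟩
    obtain ⟨i, hi⟩ := mem_iUnion.1 (hS hzS)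
    obtain ⟨w, hw, hwz⟩ := hi
    refine mem_iUnion.2 ⟨i, w, ⟨hw, ?_⟩, ?_⟩
    · show g i w ∈ e.source
      rw [hwz]; exact e.map_target hzt
    · show e (g i w) = z
      rw [hwz]; exact e.right_inv hzt
  -- reading points of `N` in the chart, and back
  have hmemC : ∀ a ∈ N, e a ∈ C := fun a ha => ha.2
  have hnotT : ∀ a ∈ N, a ∉ S → e a ∉ T := fun a ha haS h' =>
    haS (by simpa only [mem_preimage, e.left_inv ha.1] using h'.2)
  have hsymmN : ∀ z ∈ C, e.symm z ∈ N := fun z hz =>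
    ⟨e.map_target (htarget hz), by
      show e (e.symm z) ∈ C
      rw [e.right_inv (htarget hz)]; exact hz⟩
  have hsymmS : ∀ z ∈ C, z ∉ T → e.symm z ∉ S := fun z hz hzT hzS => hzT ⟨htarget hz, hzS⟩
  have hsymmc : ContinuousOn e.symm C := (continuousOn_extChartAt_symm x).mono htarget
  have hec : ContinuousOn e N := (continuousOn_extChartAt x).mono inter_subset_left
  refine ⟨N, isOpen_extChartAt_preimage' x isOpen_ball, ⟨mem_extChartAt_source x, mem_ball_self hr⟩,
    ?_, fun p hp => ?_, fun {p q} β hβ hpS hqS => ?_⟩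
  · rintro a ⟨ha, haC⟩
    simpa only [mem_preimage, e.left_inv ha] using (hball haC).2
  · -- (a): a segment in the chart ball to a point off `T`
    have hdim' : finrank ℝ P < finrank ℝ E := by omega
    obtain ⟨z, hzT, hzC⟩ :=
      (SmallSet.dense_compl hdim' h W hWo hhd hTsub).exists_mem_open isOpen_ball ⟨e p, hmemC p hp⟩
    have hseg : segment ℝ (e p) z ⊆ C := (convex_ball _ _).segment_subset (hmemC p hp) hzC
    have hj := JoinedIn.of_segment_subset hseg
    have hδm : ∀ s, hj.somePath s ∈ C := hj.somePath_mem
    have hpe : p = e.symm (e p) := (e.left_inv hp.1).symm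
    refine ⟨e.symm z, hsymmN z hzC, hsymmS z hzC hzT,
      (hj.somePath.map' (hsymmc.mono (range_subset_iff.2 hδm))).cast hpe rfl, fun s => ?_⟩
    exact hsymmN _ (hδm s)
  · -- (b): general position in the chart ball, carried back by the inverse chart
    set β₁ : Path (e p) (e q) := β.map' (hec.mono (range_subset_iff.2 hβ)) with hβ₁
    have hβ₁C : ∀ s, β₁ s ∈ C := fun s => hmemC _ (hβ s)
    have hp' : e p ∉ T := hnotT p (by simpa using hβ 0) hpS
    have hq' : e q ∉ T := hnotT q (by simpa using hβ 1) hqS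
    obtain ⟨β₁', hβ₁', hhom⟩ := exists_path_homotopicWithin_forall_notMem hdim h W hWo hhd hTsub
      isOpen_ball β₁ hβ₁C hp' hq'
    obtain ⟨β', hβ', hββ'⟩ := exists_path_of_homotopicWithin hsymmc hhom β fun s => by
      show β s = e.symm (e (β s))
      rw [e.left_inv (hβ s).1]
    refine ⟨β', fun s => ?_, hββ'⟩
    rw [hβ' s]
    exact ⟨hsymmN _ (hβ₁' s).1, hsymmS _ (hβ₁' s).1 (hβ₁' s).2⟩

end Manifold

end FriendsPi1

/-- **General position for paths near a smooth `2`-dimensional image in a `4`-manifold** (registered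
helper `helper_friendsPi1_G3_genpos`, aux part 2 of sub-goal G3 of `stub_friendsPi1`): for a smooth
`4`-manifold `X`, a smooth `f : ℝ² → X` and `S ⊆ f(ℝ²)`, about every point and inside any of its
neighbourhoods there is an open set `N` such that every point of `N` is joined inside `N` to a point of
`N ∖ S`, and every path inside `N` with end points off `S` is homotopic rel end points to a path in
`N ∖ S` (Hurewicz–Wallman (1941), Thm. IV 4, smooth local form).
[cite: HurewiczWallman1941, Ch. IV §5, Thm. IV 4 and Cor. 1] -/
theorem helper_friendsPi1_G3_genpos : ∀ (X : Type) [TopologicalSpace X] [ChartedSpace (EuclideanSpace ℝ (Fin 4)) X] [IsManifold (𝓡 4) ((⊤ : ℕ∞) : WithTop ℕ∞) X] (f : EuclideanSpace ℝ (Fin 2) → X) (S : Set X), ContMDiff (𝓡 2) (𝓡 4) ((⊤ : ℕ∞) : WithTop ℕ∞) f → S ⊆ Set.range f → ∀ (x : X) (V : Set X), V ∈ nhds x → ∃ N : Set X, IsOpen N ∧ x ∈ N ∧ N ⊆ V ∧ (∀ p ∈ N, ∃ q ∈ N, q ∉ S ∧ ∃ δ : Path p q, ∀ s, δ s ∈ N)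 ∧ (∀ (p q : X) (β : Path p q), (∀ s, β s ∈ N) → p ∉ S → q ∉ S → ∃ β' : Path p q, (∀ s, β' s ∈ N ∧ β' s ∉ S) ∧ β.Homotopic β') := by
  intro X _ _ _ f S hf hS x V hV
  have hdim : finrank ℝ (EuclideanSpace ℝ (Fin 2)) + 2 ≤ finrank ℝ (EuclideanSpace ℝ (Fin 4)) := by simp
  have hg : ContMDiffOn 𝓘(ℝ, EuclideanSpace ℝ (Fin 2)) (𝓡 4) 1 f univ :=
    (hf.of_le (by exact_mod_cast le_top)).contMDiffOn
  have hS' : S ⊆ ⋃ _ : Unit, f '' univ := by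
    rw [iUnion_const, image_univ]; exact hS
  obtain ⟨N, hNo, hxN, hNV, ha, hb⟩ := FriendsPi1.exists_goodChartNhd (J := 𝓡 4) hdim
    (fun _ : Unit => f) (fun _ => univ) (fun _ => isOpen_univ) (fun _ => hg) hS'
    BoundarylessManifold.isInteriorPoint hV
  exact ⟨N, hNo, hxN, hNV, ha, fun p q β => hb β⟩

end Summit.SmoothPoincare4.SmoothPoincare4.Theorems.DcrGap.MkFriends

end
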